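/-
Copyright (c) 2026 the pub-hodgecm2 formalisation cell (harness21).  New file.
Origin: seat `prover-pub-hodgecm2-item6-p2-g8-0` (unit pub-hodgecm2-item6-p2, TRANSPOSITION item (vi) extra prover p2, gen 8),
2026-08-21 — the PORT JOIN (J0′) under coordinator ruling HODGE FULL PORT 19:13:07Z (port_pkg 1.0, namespace KEPT `HodgeCM.*`, root
`Summits/HodgeConjecture/HodgeCM/`) and the stage-2 lead's PRE-ACK of `CorCM/PortJoin/*` (HOME/INBOX l.5270 (b)).  KERNEL only: repackaging
maps and transports, every identification `rfl`; no hypothesis binder of the Hodge kind (T5: n/a-class); count-neutral; HC_CM is NOT proved.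
-/
import Summits.HodgeConjecture.CorCM.PortJoin.Universe
import Summits.HodgeConjecture.HodgeCM.Model.Universe
import Summits.HodgeConjecture.CorCM.Assembly.ModelChainClosedH1
import HarnessLib

set_option autoImplicit false

noncomputable section

/-!
# PORT JOIN, part 2: the ported MODEL universe is the tree's model universe; `PeriodThmF` transport; the closing socket

`Universe.ofPkg (HodgeCM.Model.universeOf hHD hI hU h₃) = CorCM.Model.universeOf hHD hI hU h₃` by `rfl` (both are the same structure
literal over the same tree `Literature` objects `Var`, `BettiUniverse`, `pmsRealisation`, `cmRealisation`; only the code structures are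
duplicated, and `Universe.ofPkg` undoes exactly that).  Hence the ported head `HodgeCM.Model.periodThmF_picardCM_of_GRU_thm418C`
(`HodgeCM/Model/PeriodThmFFace.lean`:176, port layer 96) — `PeriodThmF` of the ported model universe modulo its two displayed cites
`hGRU`, `h418` — yields `PerLFace` of the tree's universe of record, and the tree's E term `hc_cm_closed_of_perLFace`
(`Assembly/ModelChainClosedH1.lean`:52) gives `HC_CM` modulo the same two cites (`PortJoin/Closed.lean`).  HC_CM is NOT proved here.
-/

namespace Summit.HodgeConjecture.CorCM.PortJoin

open Literature.AlgebraicGeometry.HodgeTheory Literature.NumberTheory.Automorphic.PicardCM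
open Literature.NumberTheory.Automorphic

/-- **The ported model universe, read as a tree universe, IS the tree's model universe** (same four record rows): both are the same
structure literal over the same tree `Literature` objects. [folklore] -/
theorem ofPkg_universeOf (hHD : exists_isReal_hodgeModel) (hI : hodgePQ_independent_of_hodgeModel)
    (hU : BallQuotientUniformisedDatum) (h₃ : CMAbelianVarietyRealised) :
    Universe.ofPkg (HodgeCM.Model.universeOf hHD hI hU h₃) = Summit.HodgeConjecture.CorCM.Model.universeOf hHD hI hU h₃ := rfl

/-- The same at `picardCMUniverse`. [folklore] -/
theorem ofPkg_picardCMUniverse (hHD : exists_isReal_hodgeModel) (hI : hodgePQ_independent_of_hodgeModel)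
    (h₁ : BallQuotientUniformised) (h₃ : CMAbelianVarietyRealised) :
    Universe.ofPkg (HodgeCM.Model.picardCMUniverse hHD hI h₁ h₃) =
      Summit.HodgeConjecture.CorCM.Model.picardCMUniverse hHD hI h₁ h₃ := rfl

/-- **TRANSPORT of `PeriodThmF`** from the ported model universe to the tree's. [folklore] -/
theorem periodThmF_of_pkg (hHD : exists_isReal_hodgeModel) (hI : hodgePQ_independent_of_hodgeModel)
    (hU : BallQuotientUniformisedDatum) (h₃ : CMAbelianVarietyRealised)
    (hP : (HodgeCM.Model.universeOf hHD hI hU h₃).PeriodThmF) :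
    (Summit.HodgeConjecture.CorCM.Model.universeOf hHD hI hU h₃).PeriodThmF :=
  ofPkg_universeOf hHD hI hU h₃ ▸ periodThmF_ofPkg _ hP

/-- The same at `picardCMUniverse`, in the `PerLFace` spelling of `CorCM/Interfaces.lean`. [folklore] -/
theorem perLFace_of_pkg (hHD : exists_isReal_hodgeModel) (hI : hodgePQ_independent_of_hodgeModel)
    (h₁ : BallQuotientUniformised) (h₃ : CMAbelianVarietyRealised)
    (hP : (HodgeCM.Model.picardCMUniverse hHD hI h₁ h₃).PeriodThmF) :
    (Summit.HodgeConjecture.CorCM.Model.picardCMUniverse hHD hI h₁ h₃).PerLFace :=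
  periodThmF_of_pkg hHD hI (ballQuotientUniformisedDatum_of h₁) h₃ hP

/-- **The port's closing socket**: `HC_CM` from the face-form period theorem of the PORTED model universe at the tree's record
rows, for ANY proof `h₃'` of (iii) (a proof of a `Prop`; the package head uses `cmAbelianVarietyRealised_of_eigenbasis …`) — the
tree's E term `hc_cm_closed_of_perLFace` after transport.
[cite: Shimura1998, §6.2 Theorem 3 (pp. 41–42)] [cite: DeligneMilne1982Tannakian, §6 Thm. 6.20 (Riemann), p. 212] -/
theorem hc_cm_closed_of_pkg_periodThmF (h₃' : CMAbelianVarietyRealised)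
    (hP : (HodgeCM.Model.picardCMUniverse exists_isReal_hodgeModel_holds hodgePQ_independent_of_hodgeModel_holds
      BallQuotient.ballQuotientUniformised_holds h₃').PeriodThmF) : HC_CM :=
  hc_cm_closed_of_perLFace (perLFace_of_pkg _ _ _ _ hP)

end Summit.HodgeConjecture.CorCM.PortJoin

end
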